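import Mathlib.RingTheory.Trace.Basic
import Mathlib.FieldTheory.IsAlgClosed.Basic
import Mathlib.Analysis.Complex.Polynomial.Basic

/-!
# `XMapKernel`, line `isogeny-orbit-collapse` — stub **R-b4**: linear independence of real radicals

Support file for the crux `IsogenyCertificates.XMapKernel` (stmt-KontsevichZagierPeriods-10663),
line `isogeny-orbit-collapse`, stub `stub_radicalIndependence` (R-b4).

**Statement (Besicovitch 1940 / Mordell 1953, over `ℚ`).** Let `x₁, …, x_r` be positive reals,
each an `m`-th root of a rational number (`m > 0`), such that no ratio `x_j / x_j'` (`j ≠ j'`) is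
rational. Then `x₁, …, x_r` are linearly independent over `ℚ`.

**Proof (trace argument).** Everything follows from one lemma on a positive real radical `z`
(`z > 0`, `z ^ N ∈ ℚ` for some `N ≥ 1`): if `d ≥ 1` is the least exponent with `z ^ d = q ∈ ℚ`,
then the minimal polynomial of `z` over `ℚ` is `X ^ d - q` (`minpoly_eq_X_pow_sub_C`). Indeed the
minimal polynomial `f` divides `X ^ d - q`, so every complex root `w` of `f` has `w ^ d = q = z ^ d`,
whence `‖w‖ = z`; as `f(0) = ± ∏ roots`, `|f(0)| = z ^ deg f` is rational, and minimality of `d`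
forces `deg f = d`. Consequently, if moreover `z ∉ ℚ` then `d ≥ 2`, the second coefficient of the
minimal polynomial vanishes, and the trace of `z` from any number field `L ∋ z` down to `ℚ` is `0`
(`trace_eq_finrank_mul_minpoly_nextCoeff`; `trace_eq_zero_of_irrational_radical`). Now let
`∑ c_j x_j = 0` and fix `t`. In the number field `L = ℚ(x₁, …, x_r) ⊂ ℝ` divide by `x_t`:
`∑ c_j (x_j / x_t) = 0`. For `j ≠ t` the quotient `x_j / x_t` is a positive real radical which is
irrational by hypothesis, so its trace vanishes, while `Tr (1) = [L : ℚ] ≠ 0`; taking traces gives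
`c_t [L : ℚ] = 0`, i.e. `c_t = 0`. No new definitions; no named facts are used.

References: A. S. Besicovitch, *On the linear independence of fractional powers of integers*,
J. London Math. Soc. 15 (1940), 3–6; L. J. Mordell, *On the linear independence of algebraic
numbers*, Pacific J. Math. 3 (1953), 625–630, Theorem 1 (real case, `K = ℚ`).
-/

noncomputable section

namespace Summit.KontsevichZagierPeriods.IsogenyCertificates.XMapKernelStubs.RadicalIndependence

open scoped BigOperators
open Polynomial Module

/-- **Minimal polynomial of a positive real radical.** If `z > 0`, `z ^ d = q ∈ ℚ` with `d ≥ 1`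
least (no smaller positive power of `z` is rational), then `minpoly ℚ z = X ^ d - C q`: every
complex root `w` of the minimal polynomial `f ∣ X ^ d - q` has `‖w‖ ^ d = q = z ^ d`, so `‖w‖ = z`
and `|f(0)| = z ^ deg f ∈ ℚ`, whence `deg f = d` by minimality. [cite: Mordell1953, Theorem 1] -/
theorem minpoly_eq_X_pow_sub_C {z : ℝ} (hz : 0 < z) {d : ℕ} (hd : 0 < d) {q : ℚ}
    (hq : z ^ d = (q : ℝ)) (hmin : ∀ k, 0 < k → k < d → ∀ a : ℚ, z ^ k ≠ (a : ℝ)) :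
    minpoly ℚ z = X ^ d - C q := by
  have hg : (X ^ d - C q : ℚ[X]).Monic := monic_X_pow_sub_C q hd.ne'
  have hgz : aeval z (X ^ d - C q : ℚ[X]) = 0 := by
    simp [hq]
  have hint : IsIntegral ℚ z := IsAlgebraic.isIntegral ⟨X ^ d - C q, hg.ne_zero, hgz⟩
  have hf : (minpoly ℚ z).Monic := minpoly.monic hint
  have hfd : minpoly ℚ z ∣ X ^ d - C q := minpoly.dvd ℚ z hgz
  -- the degree of the minimal polynomial is at least `d`
  have hdeg : d ≤ (minpoly ℚ z).natDegree := by
    by_contra hlt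
    push Not at hlt
    have he : 0 < (minpoly ℚ z).natDegree := minpoly.natDegree_pos hint
    -- pass to `ℂ`, where the minimal polynomial splits
    set fC : ℂ[X] := (minpoly ℚ z).map (algebraMap ℚ ℂ) with hfC_def
    have hsplit : fC.Splits := IsAlgClosed.splits fC
    have hfCm : fC.Monic := hf.map _
    have hfCdeg : fC.natDegree = (minpoly ℚ z).natDegree := natDegree_map _
    -- every complex root has norm `z`
    have hroot : ∀ w ∈ fC.roots, ‖w‖ = z := by
      intro w hw
      have hw' : fC.IsRoot w := (mem_roots hfCm.ne_zero).mp hw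
      have h1 : aeval w (minpoly ℚ z) = 0 := by
        rwa [IsRoot.def, hfC_def, eval_map, ← aeval_def] at hw'
      have h2 : aeval w (X ^ d - C q : ℚ[X]) = 0 := aeval_eq_zero_of_dvd_aeval_eq_zero hfd h1
      have h3 : w ^ d = (q : ℂ) := by
        simpa [sub_eq_zero] using h2
      have hq0 : (0 : ℝ) ≤ (q : ℝ) := by
        rw [← hq]
        exact pow_nonneg hz.le d
      have h4 : ‖w‖ ^ d = z ^ d := by
        rw [← norm_pow, h3, Complex.norm_ratCast, abs_of_nonneg hq0, hq]
      exact (pow_left_inj₀ (norm_nonneg w) hz.le hd.ne').mp h4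
    -- hence `|f(0)| = z ^ deg f`
    have hprod : ‖fC.roots.prod‖ = z ^ (minpoly ℚ z).natDegree := by
      have h1 : ‖fC.roots.prod‖ = (fC.roots.map (normHom : ℂ →*₀ ℝ)).prod :=
        map_multiset_prod (normHom : ℂ →*₀ ℝ) fC.roots
      have h2 : fC.roots.map (normHom : ℂ →*₀ ℝ) = fC.roots.map (fun _ => z) :=
        Multiset.map_congr rfl fun w hw => by simpa using hroot w hw
      rw [h1, h2, Multiset.map_const', Multiset.prod_replicate, ← hsplit.natDegree_eq_card_roots,
        hfCdeg]
    have hcoeff : ‖fC.coeff 0‖ = z ^ (minpoly ℚ z).natDegree := by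
      rw [hsplit.coeff_zero_eq_prod_roots_of_monic hfCm, norm_mul, norm_pow, norm_neg, norm_one,
        one_pow, one_mul, hprod]
    have hcoeff' : z ^ (minpoly ℚ z).natDegree = ((|(minpoly ℚ z).coeff 0| : ℚ) : ℝ) := by
      rw [← hcoeff, hfC_def, coeff_map, eq_ratCast, Complex.norm_ratCast, Rat.cast_abs]
    exact hmin _ he hlt _ hcoeff'
  exact (eq_of_monic_of_dvd_of_natDegree_le hf hg hfd (by rwa [natDegree_X_pow_sub_C])).symm

/-- **Trace of an irrational positive real radical vanishes.** Let `L ⊂ ℝ` be a number field and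
`z ∈ L` with `z > 0`, `z ^ N ∈ ℚ` for some `N ≥ 1`, `z ∉ ℚ`. Then `Tr_{L/ℚ} (z) = 0`: with `d ≥ 2`
the least exponent such that `z ^ d ∈ ℚ`, the minimal polynomial of `z` is `X ^ d - z ^ d`
(`minpoly_eq_X_pow_sub_C`), whose second coefficient vanishes, and
`Tr_{L/ℚ} (z) = -[L : ℚ(z)] · nextCoeff (minpoly)`. [cite: Mordell1953, Theorem 1] -/
theorem trace_eq_zero_of_irrational_radical (L : IntermediateField ℚ ℝ) [FiniteDimensional ℚ L]
    (z : L) (hz : 0 < (z : ℝ)) {N : ℕ} (hN : 0 < N) (hzN : ∃ a : ℚ, (z : ℝ) ^ N = (a : ℝ))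
    (hirr : ∀ a : ℚ, (z : ℝ) ≠ (a : ℝ)) : Algebra.trace ℚ L z = 0 := by
  classical
  have hex : ∃ k, 0 < k ∧ ∃ a : ℚ, (z : ℝ) ^ k = (a : ℝ) := ⟨N, hN, hzN⟩
  obtain ⟨hd, q, hq⟩ : 0 < Nat.find hex ∧ ∃ a : ℚ, (z : ℝ) ^ Nat.find hex = (a : ℝ) :=
    Nat.find_spec hex
  have hmin : ∀ k, 0 < k → k < Nat.find hex → ∀ a : ℚ, (z : ℝ) ^ k ≠ (a : ℝ) :=
    fun k hk hkd a hka => Nat.find_min hex hkd ⟨hk, a, hka⟩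
  have hd2 : 2 ≤ Nat.find hex := by
    by_contra h
    have hd1 : Nat.find hex = 1 := by omega
    exact hirr q (by rw [← hq, hd1, pow_one])
  have hmp : minpoly ℚ z = X ^ Nat.find hex - C q :=
    (IntermediateField.minpoly_eq z).trans (minpoly_eq_X_pow_sub_C hz hd hq hmin)
  have hnc : (X ^ Nat.find hex - C q : ℚ[X]).nextCoeff = 0 := by
    rw [nextCoeff, natDegree_X_pow_sub_C, if_neg (by omega), coeff_sub, coeff_X_pow, coeff_C,
      if_neg (by omega), if_neg (by omega), sub_zero]
  rw [trace_eq_finrank_mul_minpoly_nextCoeff, hmp, hnc, neg_zero, mul_zero]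

/-- **R-b4 — linear independence of positive real radicals over `ℚ` (Besicovitch 1940 /
Mordell 1953).** If `x₁, …, x_r > 0` are real, each `x_j ^ m` is rational (`m > 0`) and no ratio
`x_j / x_j'` (`j ≠ j'`) is rational, then `∑ c_j x_j = 0` with `c_j ∈ ℚ` forces all `c_j = 0`:
in the number field `L = ℚ(x₁, …, x_r) ⊂ ℝ`, divide the relation by `x_t` and take the trace to
`ℚ`; the traces of the irrational positive radicals `x_j / x_t` (`j ≠ t`) vanish
(`trace_eq_zero_of_irrational_radical`) while `Tr (1) = [L : ℚ] ≠ 0`, so `c_t = 0`.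
[cite: Mordell1953, Theorem 1] -/
theorem stub_radicalIndependence : ∀ (m : ℕ), 0 < m → ∀ (r : ℕ) (x : Fin r → ℝ) (c : Fin r → ℚ), (∀ j, 0 < x j) → (∀ j, ∃ a : ℚ, x j ^ m = (a : ℝ)) → (∀ j j', j ≠ j' → ¬ ∃ a : ℚ, x j = (a : ℝ) * x j') → ∑ j, (c j : ℝ) * x j = 0 → ∀ j, c j = 0 := by
  intro m hm r x c hpos hpow hirr hsum t
  classical
  -- the number field generated by the radicals
  have hint : ∀ y ∈ Set.range x, IsIntegral ℚ y := by
    rintro _ ⟨j, rfl⟩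
    obtain ⟨a, ha⟩ := hpow j
    exact IsAlgebraic.isIntegral ⟨X ^ m - C a, (monic_X_pow_sub_C a hm.ne').ne_zero, by simp [ha]⟩
  haveI : FiniteDimensional ℚ (IntermediateField.adjoin ℚ (Set.range x)) :=
    IntermediateField.finiteDimensional_adjoin hint
  set L : IntermediateField ℚ ℝ := IntermediateField.adjoin ℚ (Set.range x) with hL_def
  have hmem : ∀ j, x j ∈ L := fun j => IntermediateField.subset_adjoin ℚ _ (Set.mem_range_self j)
  -- the quotients `x_j / x_t` as elements of `L`
  set z : Fin r → L := fun j => (⟨x j, hmem j⟩ : L) / ⟨x t, hmem t⟩ with hz_def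
  have hzcoe : ∀ j, ((z j : L) : ℝ) = x j / x t := fun j => rfl
  have hxt : x t ≠ 0 := (hpos t).ne'
  -- the relation, divided by `x_t`, inside `L`
  have hrel : ∑ j, c j • z j = 0 := by
    apply Subtype.ext
    rw [IntermediateField.coe_sum, ZeroMemClass.coe_zero]
    simp only [Rat.smul_def, MulMemClass.coe_mul, SubfieldClass.coe_ratCast, hzcoe]
    have : ∑ j, (c j : ℝ) * (x j / x t) = (∑ j, (c j : ℝ) * x j) / x t := by
      rw [Finset.sum_div]
      refine Finset.sum_congr rfl fun j _ => ?_
      ring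
    rw [this, hsum, zero_div]
  -- take the trace down to `ℚ`
  have htr := congrArg (Algebra.trace ℚ L) hrel
  rw [map_sum, map_zero] at htr
  simp only [map_smul, smul_eq_mul] at htr
  rw [Finset.sum_eq_single t ?_ (fun h => absurd (Finset.mem_univ t) h)] at htr
  · -- `c_t · [L : ℚ] = 0`
    have hzt : z t = 1 := div_self (fun h => hxt (by simpa using congrArg Subtype.val h))
    have htr1 : Algebra.trace ℚ L 1 = (finrank ℚ L : ℚ) := by
      simpa using Algebra.trace_algebraMap (R := ℚ) (S := L) 1
    have hfr : (finrank ℚ L : ℚ) ≠ 0 := by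
      exact_mod_cast (Module.finrank_pos (R := ℚ) (M := L)).ne'
    rw [hzt, htr1] at htr
    exact (mul_eq_zero.mp htr).resolve_right hfr
  · -- the traces of the irrational radicals `x_j / x_t`, `j ≠ t`, vanish
    intro j _ hjt
    have hzpos : 0 < ((z j : L) : ℝ) := by
      rw [hzcoe]
      exact div_pos (hpos j) (hpos t)
    have hzpow : ∃ a : ℚ, ((z j : L) : ℝ) ^ m = (a : ℝ) := by
      obtain ⟨a, ha⟩ := hpow j
      obtain ⟨b, hb⟩ := hpow t
      exact ⟨a / b, by rw [hzcoe, div_pow, ha, hb, Rat.cast_div]⟩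
    have hzirr : ∀ a : ℚ, ((z j : L) : ℝ) ≠ (a : ℝ) := by
      intro a ha
      rw [hzcoe, div_eq_iff hxt] at ha
      exact hirr j t hjt ⟨a, ha⟩
    rw [trace_eq_zero_of_irrational_radical L (z j) hzpos hm hzpow hzirr, mul_zero]

end Summit.KontsevichZagierPeriods.IsogenyCertificates.XMapKernelStubs.RadicalIndependence
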